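import Mathlib
import Summits.ValiantsHypothesis.ValiantsHypothesis.Theorems.ProofCarryingSymmetryRestorationQPUnitEq

/-!
# Route ProofCarryingSymmetry — crux `RestorationQP`, line `registered`, rung S3‴ under stub S2″ (`stub_proofsToACEquiv`), part 2:
the unit normaliser

Continuation of `…RestorationQPUnitEq.lean` (`ACStability.UEq`, formulas modulo associativity,
commutativity and the unit laws A7–A9).  The unit laws are absorbed by NORMALISING before taking
AC-classes:

* `uadd a b` / `umul a b` — the smart sum and product: drop a summand `0`, collapse a product with a
  factor `0` to `0`, drop a factor `1` (only the constants `0`, `1` are inspected);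
* `unorm F` — the bottom-up normal form of `F` built with `uadd`/`umul`, leaves unchanged; it
  commutes with renaming (`unorm_rename`) and does not increase the size (`size_unorm_le`) (its
  semantics `eval_unorm` and the subformula control `subs_unorm_subset` are in part 3);
* THE KEY LEMMA `acEq_unorm_of_uEq`: `UEq F G → ACEq (unorm F) (unorm G)` (as soon as `0 ≠ 1` in
  `𝔽`) — ACU-equivalent formulas have AC-equivalent normal forms (induction on `UEq`; the leaves
  `const 0`, `const 1` are AC-rigid, `ACEq.eq_of_const`), whence the registered helper
  `proofsToACEquiv_aux_unitNorm` (normal forms of ACU-equivalent formulas are inter-derivable in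
  `P_f(ℂ)` without A6–A10, by completeness of the AC fragment, `pfProvable_of_acEq`).

Everything is elementary and proved; no named facts.
-/

-- single-problem summit: `Summit.ValiantsHypothesis.ValiantsHypothesis.…` is the namespace by design (D-0017)
set_option linter.dupNamespace false

noncomputable section

open scoped Classical

namespace Summit.ValiantsHypothesis.ValiantsHypothesis.Theorems

namespace ACStability

open Literature.Computability.AlgebraicComplexity ACClass

universe u v w

variable {𝔽 : Type u} {X : Type v} {Y : Type w}

/-! ### Instance-free preliminaries -/

/-- Renaming detects constants. [folklore] -/
theorem rename_eq_const_iff (f : X → Y) (F : PIFormula 𝔽 X) (c : 𝔽) :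
    F.rename f = .const c ↔ F = .const c := by
  cases F <;> simp [PIFormula.rename]

/-- AC-equivalence detects each constant leaf. [folklore] -/
theorem ACEq.eq_const_iff {F G : PIFormula 𝔽 X} (h : ACEq F G) (c : 𝔽) :
    F = .const c ↔ G = .const c := by
  constructor
  · rintro rfl; exact h.eq_of_const
  · rintro rfl; exact h.symm.eq_of_const

/-! ### The smart sum (only `0` is inspected) -/

section Add

variable [Zero 𝔽]

/-- The smart sum: `0 + b ↦ b`, `a + 0 ↦ a`, otherwise the gate `a + b`. [folklore] -/
def uadd (a b : PIFormula 𝔽 X) : PIFormula 𝔽 X :=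
  if a = .const 0 then b else if b = .const 0 then a else .add a b

/-- `0 + b ↦ b`. [folklore] -/
@[simp] theorem uadd_zero_left (b : PIFormula 𝔽 X) : uadd (.const 0) b = b := by
  simp [uadd]

/-- `a + 0 ↦ a`. [folklore] -/
@[simp] theorem uadd_zero_right (a : PIFormula 𝔽 X) : uadd a (.const 0) = a := by
  unfold uadd
  split_ifs with h h'
  · exact h.symm
  · rfl
  · exact absurd rfl h'

/-- The generic case of the smart sum. [folklore] -/
theorem uadd_of_ne {a b : PIFormula 𝔽 X} (ha : a ≠ .const 0) (hb : b ≠ .const 0) :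
    uadd a b = .add a b := by
  simp [uadd, ha, hb]

/-- The smart sum commutes with renaming. [folklore] -/
theorem uadd_rename (f : X → Y) (a b : PIFormula 𝔽 X) :
    uadd (a.rename f) (b.rename f) = (uadd a b).rename f := by
  unfold uadd
  simp only [rename_eq_const_iff]
  split_ifs <;> rfl

/-- The smart sum is at most as large as the gate. [folklore] -/
theorem size_uadd_le (a b : PIFormula 𝔽 X) : (uadd a b).size ≤ a.size + b.size + 1 := by
  unfold uadd
  split_ifs
  · omega
  · omega
  · simp

/-- The smart sum respects AC-equivalence. [folklore] -/
theorem ACEq.uadd_congr {a a' b b' : PIFormula 𝔽 X} (ha : ACEq a a') (hb : ACEq b b') :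
    ACEq (uadd a b) (uadd a' b') := by
  by_cases h1 : a = .const 0
  · have h1' : a' = .const 0 := (ha.eq_const_iff 0).1 h1
    subst h1 h1'
    rwa [uadd_zero_left, uadd_zero_left]
  have h1' : a' ≠ .const 0 := fun h => h1 ((ha.eq_const_iff 0).2 h)
  by_cases h2 : b = .const 0
  · have h2' : b' = .const 0 := (hb.eq_const_iff 0).1 h2
    subst h2 h2'
    rwa [uadd_zero_right, uadd_zero_right]
  have h2' : b' ≠ .const 0 := fun h => h2 ((hb.eq_const_iff 0).2 h)
  rw [uadd_of_ne h1 h2, uadd_of_ne h1' h2']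
  exact ha.add_congr hb

/-- The smart sum is commutative up to AC. [folklore] -/
theorem acEq_uadd_comm (a b : PIFormula 𝔽 X) : ACEq (uadd a b) (uadd b a) := by
  by_cases ha : a = .const 0
  · subst ha
    rw [uadd_zero_left, uadd_zero_right]
    exact .refl _
  by_cases hb : b = .const 0
  · subst hb
    rw [uadd_zero_left, uadd_zero_right]
    exact .refl _
  rw [uadd_of_ne ha hb, uadd_of_ne hb ha]
  exact .add_comm _ _

/-- The smart sum is associative up to AC. [folklore] -/
theorem acEq_uadd_assoc (a b c : PIFormula 𝔽 X) :
    ACEq (uadd a (uadd b c)) (uadd (uadd a b) c) := by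
  by_cases ha : a = .const 0
  · subst ha
    simp only [uadd_zero_left]
    exact .refl _
  by_cases hb : b = .const 0
  · subst hb
    simp only [uadd_zero_left, uadd_zero_right]
    exact .refl _
  by_cases hc : c = .const 0
  · subst hc
    simp only [uadd_zero_right]
    exact .refl _
  have hbc : PIFormula.add b c ≠ .const 0 := by simp
  have hab : PIFormula.add a b ≠ .const 0 := by simp
  rw [uadd_of_ne hb hc, uadd_of_ne ha hb, uadd_of_ne ha hbc, uadd_of_ne hab hc]
  exact .add_assoc _ _ _

end Add

/-! ### The smart product and the normal form -/

section Norm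

variable [Zero 𝔽] [One 𝔽]

/-- The smart product: a factor `0` gives `0`, `1 · b ↦ b`, `a · 1 ↦ a`, otherwise the gate `a · b`.
[folklore] -/
def umul (a b : PIFormula 𝔽 X) : PIFormula 𝔽 X :=
  if a = .const 0 ∨ b = .const 0 then .const 0
  else if a = .const 1 then b else if b = .const 1 then a else .mul a b

/-- The unit normal form: smart sums and products bottom-up, leaves unchanged. [folklore] -/
def unorm : PIFormula 𝔽 X → PIFormula 𝔽 X
  | .add F G => uadd (unorm F) (unorm G)
  | .mul F G => umul (unorm F) (unorm G)
  | F => F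

/-- Unfolding of `unorm`. [folklore] -/
@[simp] theorem unorm_var (x : X) : unorm (.var x : PIFormula 𝔽 X) = .var x := rfl
/-- Unfolding of `unorm`. [folklore] -/
@[simp] theorem unorm_const (c : 𝔽) : unorm (.const c : PIFormula 𝔽 X) = .const c := rfl
/-- Unfolding of `unorm`. [folklore] -/
@[simp] theorem unorm_add (F G : PIFormula 𝔽 X) : unorm (.add F G) = uadd (unorm F) (unorm G) := rfl
/-- Unfolding of `unorm`. [folklore] -/
@[simp] theorem unorm_mul (F G : PIFormula 𝔽 X) : unorm (.mul F G) = umul (unorm F) (unorm G) := rfl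

/-- A factor `0` kills the smart product. [folklore] -/
theorem umul_eq_zero_of {a b : PIFormula 𝔽 X} (h : a = .const 0 ∨ b = .const 0) :
    umul a b = .const 0 := by
  unfold umul
  exact if_pos h

/-- `1 · b ↦ b` (for `b ≠ 0`, when `0 ≠ 1`). [folklore] -/
theorem umul_one_left [NeZero (1 : 𝔽)] {b : PIFormula 𝔽 X} (hb : b ≠ .const 0) :
    umul (.const 1) b = b := by
  simp [umul, hb]

/-- `a · 1 ↦ a` (for `a ≠ 0`, when `0 ≠ 1`). [folklore] -/
theorem umul_one_right [NeZero (1 : 𝔽)] {a : PIFormula 𝔽 X} (ha : a ≠ .const 0) :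
    umul a (.const 1) = a := by
  unfold umul
  split_ifs with h1 h2 h3
  · simp [ha] at h1
  · exact h2.symm
  · rfl
  · exact absurd rfl h3

/-- The generic case of the smart product. [folklore] -/
theorem umul_of_ne {a b : PIFormula 𝔽 X} (ha0 : a ≠ .const 0) (hb0 : b ≠ .const 0)
    (ha1 : a ≠ .const 1) (hb1 : b ≠ .const 1) : umul a b = .mul a b := by
  simp [umul, ha0, hb0, ha1, hb1]

/-- A smart product of nonzero factors is not `0` (when `0 ≠ 1`). [folklore] -/
theorem umul_ne_zero [NeZero (1 : 𝔽)] {a b : PIFormula 𝔽 X} (ha : a ≠ .const 0) (hb : b ≠ .const 0) :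
    umul a b ≠ .const 0 := by
  by_cases ha1 : a = .const 1
  · subst ha1; rwa [umul_one_left hb]
  by_cases hb1 : b = .const 1
  · subst hb1; rwa [umul_one_right ha]
  rw [umul_of_ne ha hb ha1 hb1]
  simp

/-! ### Renaming, size -/

/-- The smart product commutes with renaming. [folklore] -/
theorem umul_rename (f : X → Y) (a b : PIFormula 𝔽 X) :
    umul (a.rename f) (b.rename f) = (umul a b).rename f := by
  unfold umul
  simp only [rename_eq_const_iff]
  split_ifs <;> rfl

/-- **The normal form commutes with renaming** (only constants are inspected). [folklore] -/
theorem unorm_rename (f : X → Y) (F : PIFormula 𝔽 X) : unorm (F.rename f) = (unorm F).rename f := by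
  induction F with
  | var x => rfl
  | const c => rfl
  | add F G ihF ihG => simp only [PIFormula.rename, unorm_add, ihF, ihG, uadd_rename]
  | mul F G ihF ihG => simp only [PIFormula.rename, unorm_mul, ihF, ihG, umul_rename]

/-- The smart product is at most as large as the gate. [folklore] -/
theorem size_umul_le (a b : PIFormula 𝔽 X) : (umul a b).size ≤ a.size + b.size + 1 := by
  unfold umul
  split_ifs
  · simp only [PIFormula.size_const]; omega
  · omega
  · omega
  · simp

/-- **Normalising does not increase the size.** [folklore] -/
theorem size_unorm_le (F : PIFormula 𝔽 X) : (unorm F).size ≤ F.size := by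
  induction F with
  | var x => simp
  | const c => simp
  | add F G ihF ihG => exact (size_uadd_le _ _).trans (by simp only [PIFormula.size_add]; omega)
  | mul F G ihF ihG => exact (size_umul_le _ _).trans (by simp only [PIFormula.size_mul]; omega)

/-! ### The key lemma: ACU-equivalent formulas have AC-equivalent normal forms -/

/-- The smart product respects AC-equivalence (when `0 ≠ 1`). [folklore] -/
theorem ACEq.umul_congr [NeZero (1 : 𝔽)] {a a' b b' : PIFormula 𝔽 X} (ha : ACEq a a')
    (hb : ACEq b b') : ACEq (umul a b) (umul a' b') := by
  by_cases h0 : a = .const 0 ∨ b = .const 0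
  · have h0' : a' = .const 0 ∨ b' = .const 0 :=
      h0.imp (ha.eq_const_iff 0).1 (hb.eq_const_iff 0).1
    rw [umul_eq_zero_of h0, umul_eq_zero_of h0']
    exact .refl _
  have ha0 : a ≠ .const 0 := fun h => h0 (Or.inl h)
  have hb0 : b ≠ .const 0 := fun h => h0 (Or.inr h)
  have ha0' : a' ≠ .const 0 := fun h => ha0 ((ha.eq_const_iff 0).2 h)
  have hb0' : b' ≠ .const 0 := fun h => hb0 ((hb.eq_const_iff 0).2 h)
  by_cases ha1 : a = .const 1
  · have ha1' : a' = .const 1 := (ha.eq_const_iff 1).1 ha1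
    subst ha1 ha1'
    rwa [umul_one_left hb0, umul_one_left hb0']
  have ha1' : a' ≠ .const 1 := fun h => ha1 ((ha.eq_const_iff 1).2 h)
  by_cases hb1 : b = .const 1
  · have hb1' : b' = .const 1 := (hb.eq_const_iff 1).1 hb1
    subst hb1 hb1'
    rwa [umul_one_right ha0, umul_one_right ha0']
  have hb1' : b' ≠ .const 1 := fun h => hb1 ((hb.eq_const_iff 1).2 h)
  rw [umul_of_ne ha0 hb0 ha1 hb1, umul_of_ne ha0' hb0' ha1' hb1']
  exact ha.mul_congr hb

/-- The smart product is commutative up to AC (when `0 ≠ 1`). [folklore] -/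
theorem acEq_umul_comm [NeZero (1 : 𝔽)] (a b : PIFormula 𝔽 X) : ACEq (umul a b) (umul b a) := by
  by_cases h0 : a = .const 0 ∨ b = .const 0
  · rw [umul_eq_zero_of h0, umul_eq_zero_of h0.symm]
    exact .refl _
  have ha0 : a ≠ .const 0 := fun h => h0 (Or.inl h)
  have hb0 : b ≠ .const 0 := fun h => h0 (Or.inr h)
  by_cases ha1 : a = .const 1
  · subst ha1
    rw [umul_one_left hb0, umul_one_right hb0]
    exact .refl _
  by_cases hb1 : b = .const 1
  · subst hb1
    rw [umul_one_left ha0, umul_one_right ha0]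
    exact .refl _
  rw [umul_of_ne ha0 hb0 ha1 hb1, umul_of_ne hb0 ha0 hb1 ha1]
  exact .mul_comm _ _

/-- The smart product is associative up to AC (when `0 ≠ 1`). [folklore] -/
theorem acEq_umul_assoc [NeZero (1 : 𝔽)] (a b c : PIFormula 𝔽 X) :
    ACEq (umul a (umul b c)) (umul (umul a b) c) := by
  by_cases ha : a = .const 0
  · rw [umul_eq_zero_of (Or.inl ha), umul_eq_zero_of (Or.inl (umul_eq_zero_of (Or.inl ha)))]
    exact .refl _
  by_cases hb : b = .const 0
  · rw [umul_eq_zero_of (Or.inr (umul_eq_zero_of (Or.inl hb))),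
      umul_eq_zero_of (Or.inl (umul_eq_zero_of (Or.inr hb)))]
    exact .refl _
  by_cases hc : c = .const 0
  · rw [umul_eq_zero_of (Or.inr (umul_eq_zero_of (Or.inr hc))), umul_eq_zero_of (Or.inr hc)]
    exact .refl _
  by_cases ha1 : a = .const 1
  · subst ha1
    rw [umul_one_left (umul_ne_zero hb hc), umul_one_left hb]
    exact .refl _
  by_cases hb1 : b = .const 1
  · subst hb1
    rw [umul_one_left hc, umul_one_right ha]
    exact .refl _
  by_cases hc1 : c = .const 1
  · subst hc1
    rw [umul_one_right hb, umul_one_right (umul_ne_zero ha hb)]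
    exact .refl _
  have hbc0 : PIFormula.mul b c ≠ .const 0 := by simp
  have hbc1 : PIFormula.mul b c ≠ .const 1 := by simp
  have hab0 : PIFormula.mul a b ≠ .const 0 := by simp
  have hab1 : PIFormula.mul a b ≠ .const 1 := by simp
  rw [umul_of_ne hb hc hb1 hc1, umul_of_ne ha hb ha1 hb1, umul_of_ne ha hbc0 ha1 hbc1,
    umul_of_ne hab0 hc hab1 hc1]
  exact .mul_assoc _ _ _

/-- **The key lemma.** ACU-equivalent formulas have AC-equivalent unit normal forms (over constants
with `0 ≠ 1`; in the zero ring `x · 1 = x` and `x · 0 = 0` would identify `x` with `0`). [folklore] -/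
theorem acEq_unorm_of_uEq [NeZero (1 : 𝔽)] {F G : PIFormula 𝔽 X} (h : UEq F G) :
    ACEq (unorm F) (unorm G) := by
  induction h with
  | refl F => exact .refl _
  | symm _ ih => exact ih.symm
  | trans _ _ ih₁ ih₂ => exact ih₁.trans ih₂
  | add_congr _ _ ih₁ ih₂ => exact ih₁.uadd_congr ih₂
  | mul_congr _ _ ih₁ ih₂ => exact ih₁.umul_congr ih₂
  | add_comm F G => exact acEq_uadd_comm _ _
  | add_assoc F G H => exact acEq_uadd_assoc _ _ _
  | mul_comm F G => exact acEq_umul_comm _ _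
  | mul_assoc F G H => exact acEq_umul_assoc _ _ _
  | add_zero F =>
    rw [unorm_add, unorm_const, uadd_zero_right]
    exact .refl _
  | mul_zero F =>
    rw [unorm_mul, unorm_const, umul_eq_zero_of (Or.inr rfl)]
    exact .refl _
  | mul_one F =>
    rw [unorm_mul, unorm_const]
    by_cases h : unorm F = .const 0
    · rw [umul_eq_zero_of (Or.inl h), h]
      exact .refl _
    · rw [umul_one_right h]
      exact .refl _

/-- With AC-soundness/completeness: ACU-equivalent formulas have normal forms inter-derivable in
`P_f` without A6–A10. [folklore] -/
theorem mk_unorm_eq_of_uEq [NeZero (1 : 𝔽)] {F G : PIFormula 𝔽 X} (h : UEq F G) :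
    mk (unorm F) = mk (unorm G) :=
  mk_eq_mk.2 (acEq_unorm_of_uEq h)

end Norm

end ACStability

open Literature.Computability.AlgebraicComplexity in
/-- **Unit laws are absorbed by normalising** (helper under stub S2″ `stub_proofsToACEquiv`, crux
`RestorationQP`, rung S3‴): over `ℂ`, formulas in the matrix variables that are equal modulo
associativity, commutativity and the unit laws A7–A9 have unit normal forms that are equal modulo
associativity and commutativity, i.e. inter-derivable in `P_f(ℂ)` without A6–A10. [folklore] -/
theorem proofsToACEquiv_aux_unitNorm : ∀ (n : ℕ) (F G : PIFormula ℂ (Fin n × Fin n)), ACStability.UEq F G → (pfSystem ℂ (Fin n × Fin n)).Provable (ACStability.unorm F) (ACStability.unorm G) ⊤ (fun s => if s = PIAxiom.A6 ∨ s = PIAxiom.A7 ∨ s = PIAxiom.A8 ∨ s = PIAxiom.A9 ∨ s = PIAxiom.A10 then 0 else ⊤) := by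
  intro n F G h
  exact ACStability.pfProvable_of_acEq (ACStability.acEq_unorm_of_uEq h)

end Summit.ValiantsHypothesis.ValiantsHypothesis.Theorems

end
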